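import Summits.Parity.GeneralizedHardyLittlewood.Theses.MaynardProductExact
import Literature.NumberTheory.Sieve.MaynardProductKernelCert3750Lit
import Literature.NumberTheory.Sieve.MaynardProductKernelCert3750Table

/-! # Route `MaynardProductExact` — crux `NumLB3749` (stmt-Parity-19245): table, chain, threshold, quarter and side kernel facts

Helper for `Theorems/MaynardProductExactNumLB3749.lean`: `okT` certifies the literal log-weight table `TLIT` (`FactTab`: 1100 entries against
`tabFn`, i.e. `KernelLog.logIv`), `okCh` the fifteen no-carry checks of the floor chain (`FactCh`), `okFin` the threshold on the eight slice literals
(`FactFin`), `okQ0–okQ2` the three quarters of `Σ j·leaf_j` (`FactQ`, literals = exact ± 2^30) and `okS` the Hoeffding side conditions (`FactS`).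
All by `decide +kernel`.  No summit is proved by this file. -/

open Literature.NumberTheory.Sieve.MaynardTao.ProductKernelCert3750

namespace Summit.Parity.GeneralizedHardyLittlewood.MaynardProductExactNumLB3749

set_option maxHeartbeats 0 in
/-- kernel fact T: the literal table is below the `logIv` lower bounds. -/
theorem okT : FactTab TLIT = true := by decide +kernel
set_option maxHeartbeats 0 in
/-- kernel fact Ch: the fifteen no-carry checks of the 15-step floor chain. -/
theorem okCh : FactCh = true := by decide +kernel
/-- kernel fact Fin: `T2 ≤ Σ L_s` and the threshold `19076·10⁻¹⁰·2^208·3749² ≤ Σ L_s − T2`. -/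
theorem okFin : FactFin 888425779255341279287309424489850393100641466283923382403799 36812006923911455380084517001838234665501915186434976839700010 331089555579136358545337082849582879087569268619751909361341644 1146072400280261097053938402104368879496748407143254210097024738
    2169407815381707424124416892535072055231290502243258173363397455 2791181304074851417406877824547125030940714193101287486263720735 2741152490876019191678786206347630533059497024527226121839144134 1815531870551499835547916166847022961381536289598888714236566336 = true := by decide +kernel
set_option maxHeartbeats 0 in
/-- kernel fact Q0: first quarter of `Σ j·leaf_j` (exact ± 2^30). -/
theorem okQ0 : FactQ 0 77556771781919024 77556773929402672 = true := by decide +kernel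
set_option maxHeartbeats 0 in
/-- kernel fact Q1. -/
theorem okQ1 : FactQ (0 + 2 ^ 18) 6792835829894453 6792837977378101 = true := by decide +kernel
set_option maxHeartbeats 0 in
/-- kernel fact Q2. -/
theorem okQ2 : FactQ (0 + 2 ^ (18 + 1)) 3973827995937436 3973830143421084 = true := by decide +kernel
set_option maxHeartbeats 0 in
/-- kernel fact S: log enclosure and both Hoeffding side conditions on the literal quarter sums. -/
theorem okS : FactS 77556771781919024 6792835829894453 3973827995937436 77556773929402672 6792837977378101 3973830143421084 = true := by decide +kernel

end Summit.Parity.GeneralizedHardyLittlewood.MaynardProductExactNumLB3749
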